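import Summits.BirchSwinnertonDyer.BirchSwinnertonDyer.Theorems.AlignedTransportAtTwoMainConjectureOfRankZeroBSDAtTwoCubicOffStratumFukudaIndexDoors
import Summits.BirchSwinnertonDyer.BirchSwinnertonDyer.Theorems.AlignedTransportAtTwoMainConjectureOfRankZeroBSDAtTwoCubicRankDoorLayerOne
import HarnessLib

/-!
# Route `AlignedTransportAtTwo`, crux C2 `MainConjectureOfRankZeroBSDAtTwo` (stmt-BirchSwinnertonDyer-22298):
# THE ROW AT THE OFF-STRATUM SEED `2045b1` (`Δ_min ≡ 3 (mod 8)`, `2 = 𝔭₁𝔭₂²` in `ℚ(β)`): Fukuda's index is `0` in the kernel, so `MC₂(2045b1)` follows from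
# PRINT + ONE certificate at the layer pair `(0, 1)` — equal `2`-ranks (or equal `2`-class-number exponents) of `Cl(ℚ(β))` and `Cl(ℚ(β)(√2))` — or from Chevalley's bits

HONEST FRAMING (cell `bsd-f1-sign2`, WIDTH-5 attached prover seat `bsd-line-att-p5` gen 28 on line `birth` of the lead `bsd-line-att-p2`;
`--supports` stmt-BirchSwinnertonDyer-22298, closes nothing; BSD is NOT proved by any of this; the crux C2, its verdict «blocked-on
`Rank1Residual.GreenbergMuConjectureIrreducible`» and every registered stub are untouched). THEOREMS ONLY — no definition, no named fact, no `sorry`;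
CONDITIONAL rows (PRINT⁵, Creutz–Miller, MuIneqʳ and ONE class-group certificate displayed; the certificate is a finite computation NOT performed here —
-data CENSUS ASK: the `2`-ranks / `2`-parts of `h` for `K = ℚ(β)`, `β³ − 3β² − 87520β − 55211200 = 0` up to scaling, and `K(√2)`). Sequel of att-p4 g24's
`…CubicRankDoorLayerOne.mazurMainConjecture_two_2045b1_of_rankCert` (pair `(n, n+1)` with `1 ≤ n`) and of att-p5 g28's `…CubicOffStratumFukudaIndex{,Doors}`.

* `totallyRamifiedFrom_zero_2045b1` — the bit itself: every cyclotomic `ℤ₂`-extension of `ℚ(β)` (`β` a root of the `2`-division cubic of `2045b1`) has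
  Fukuda index `0`.
* `mazurMainConjecture_two_2045b1_of_rankCert_anyLayer` (ONE pair `(n, n+1)`, ANY `n ≥ 0`), `…_of_rankCert_layerZero` (`rank₂ Cl(ℚ(β)(√2)) = rank₂ Cl(ℚ(β))`
  in every cyclotomic tower), `…_of_classNumberCert_layerZero` (`ord₂ h(ℚ(β)(√2)) = ord₂ h(ℚ(β))`), `…_of_chevalley` (`h(ℚ(β))` odd + a unit `≠ a² − 2b²`).

References: [Fukuda1994] Thm. 1 (1)(2), p. 264; [CreutzMiller2012] Thm. 1.1; [Kato2004Asterisque] Thm. 17.4 (1)(2) (p. 273); [GreenbergLNM1716] Thm. 4.1,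
Conj. 1.11; [Lang1990] Ch. 13 §4 Lemma 4.1; [CremonaAlgorithms1997] Table 1 (2045b1).
-/

set_option linter.dupNamespace false
set_option autoImplicit false

noncomputable section

open scoped Classical NumberField nonZeroDivisors

open NumberField IsDedekindDomain Polynomial WeierstrassCurve IntermediateField CongruenceSubgroup
  Literature.NumberTheory.IwasawaTheory Literature.NumberTheory.GaloisRepresentations
  Literature.NumberTheory.EllipticCurves Literature.NumberTheory.EllipticCurves.Greenberg1999
  Literature.NumberTheory.EllipticCurves.ModularForms
  Literature.NumberTheory.EllipticCurves.Rank1Residual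
  Literature.NumberTheory.EllipticCurves.Module
  Summit.BirchSwinnertonDyer.Rank1Residual
  Summit.BirchSwinnertonDyer.Rank1Residual.X1.MuLambda
  Summit.BirchSwinnertonDyer.Rank1Residual.X5
  Summit.BirchSwinnertonDyer.Rank1Residual.F1Sign2
  Summit.BirchSwinnertonDyer.BirchSwinnertonDyer.Theorems.Rank1ResidualX1Defs
  Summit.BirchSwinnertonDyer.BirchSwinnertonDyer.Theses.AlignedTransportAtTwo
  Summit.BirchSwinnertonDyer.BirchSwinnertonDyer.Theorems.TowerClass
  Summit.BirchSwinnertonDyer.BirchSwinnertonDyer.Theorems.AlignedTransportAtTwoOffStratumRow2045b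
  Summit.BirchSwinnertonDyer.BirchSwinnertonDyer.Theorems.AlignedTransportAtTwoTwistFamilySmallSeeds
  Summit.BirchSwinnertonDyer.BirchSwinnertonDyer.Theorems.AlignedTransportAtTwoCubicRankDoorLayerOne
  Summit.BirchSwinnertonDyer.BirchSwinnertonDyer.Theorems.AlignedTransportAtTwoCubicOffStratumFukudaIndex
  Summit.BirchSwinnertonDyer.BirchSwinnertonDyer.Theorems.AlignedTransportAtTwoCubicOffStratumFukudaIndexDoors

namespace Summit.BirchSwinnertonDyer.BirchSwinnertonDyer.Theorems.AlignedTransportAtTwoCubicOffStratumFukudaIndexRow2045b1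

/-- **Fukuda's index is `0` for the cubic field of `2045b1`** (`Δ_min ≡ 3 (mod 8)`; `β` any root of its `2`-division cubic; every cyclotomic `ℤ₂`-extension):
the prime `𝔭₂` (`e = 2`) of `ℚ(β)` ramifies again in `ℚ(β)(√2)`. [cite: Fukuda1994, p. 264 (the index `n₀`)] [cite: CremonaAlgorithms1997, Table 1] -/
theorem totallyRamifiedFrom_zero_2045b1 {β : AlgebraicClosure ℚ} (hβ : aeval β c2045b1.twoTorsionPolynomial.toPoly = 0)
    (κP : ZpExtension ℚ⟮β⟯ 2) (hκP : κP.IsCyclotomic) : TotallyRamifiedFrom κP 0 :=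
  totallyRamifiedFrom_zero_adjoin_of_minimalDiscriminantInt_emod_four_eq_three c2045b1 goodOrd_two_2045b1 not_hasRationalTwoTorsionX_2045b1
    minimalDiscriminantInt_emod_four_2045b1 hβ κP hκP

/-- **THE ROW AT `2045b1`, RANK certificate at ANY layer pair.** Granted PRINT⁵ (`h17`, `hGr`, `hper`, `hmod`, `hGZK`), Creutz–Miller (`hCM`) for `BSD₂(2045b1)`,
MuIneqʳ verbatim (`hI`), the seed's analytic data (`hr0`, `hμan`), a root `β`, and for every cyclotomic `ℤ₂`-extension of `ℚ(β)` ONE pair `(n, n+1)`, ANY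
`n ≥ 0`, with equal `2`-ranks of the class groups: `MC₂(2045b1)`. CONDITIONAL; BSD is NOT proved. [cite: Fukuda1994, Thm. 1 (2), p. 264] [cite: CreutzMiller2012, Thm. 1.1]
[cite: Kato2004Asterisque, Thm. 17.4 (1)(2) (p. 273)] -/
theorem mazurMainConjecture_two_2045b1_of_rankCert_anyLayer
    (h17 : ∀ [NeZero (c2045b1.conductorNorm ℤ)] (f : CuspForm (Gamma0 (c2045b1.conductorNorm ℤ)) 2),
      kato_divisibility_allPrimes c2045b1 2 (f := f))
    (hGr : Greenberg1999.thm41_charValue_rankZero_anyPrime)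
    (hper : realPeriodRat_eq_unit_mul_plusPeriod_two) (hmod : nonempty_modularParametrizationData)
    (hGZK : rank_eq_analyticRank_of_analyticRank_le_one) (hCM : bsdTriple_of_rank_le_one_of_conductor_lt)
    (hI : ∀ (W : WeierstrassCurve ℚ) [W.IsElliptic] [W.IsGloballyMinimal], IsOrdinaryAt W 2 →
      (∀ x : ℚ, ¬ HasRationalTwoTorsionX W x) →
      ∀ (κ : ZpExtension ℚ 2) (γ : Field.absoluteGaloisGroup ℚ), κ.IsCyclotomic →
      κ.IsTopGenerator γ → IsCyclotomicVariable 2 γ →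
      ∀ ⦃N : ℕ⦄ [NeZero N] (f : CuspForm (Gamma0 N) 2), IsNewformOf W f →
      ∀ Gp : IwasawaAlgebra 2, iwasawaToPowerSeries 2 Gp = padicLFunction f (unitRoot W 2 : ℚ_[2]) →
      ∀ (D : W.SelmerDualData κ γ) (Yr : W.FineSelmerDualDataRelaxedInf κ γ),
        lengthAt (IwasawaAlgebra 2) D.X ⟨IwasawaAlgebra.augIdealP 2, IwasawaAlgebra.isPrime_augIdealP_holds 2⟩ ≤
          lengthAt (IwasawaAlgebra 2) (IwasawaAlgebra 2 ⧸ Ideal.span {Gp})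
              ⟨IwasawaAlgebra.augIdealP 2, IwasawaAlgebra.isPrime_augIdealP_holds 2⟩ +
            lengthAt (IwasawaAlgebra 2) Yr.X ⟨IwasawaAlgebra.augIdealP 2, IwasawaAlgebra.isPrime_augIdealP_holds 2⟩)
    (hr0 : c2045b1.analyticRank = 0)
    (hμan : ∀ ⦃N : ℕ⦄ [NeZero N] (f : CuspForm (Gamma0 N) 2), IsNewformOf c2045b1 f →
      ∀ G : IwasawaAlgebra 2, IsEvenBranchLiftAtTwo c2045b1 f G → red G ≠ 0)
    {β : AlgebraicClosure ℚ} (hβ : aeval β c2045b1.twoTorsionPolynomial.toPoly = 0)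
    (hcert : ∀ κP : ZpExtension ↥(IntermediateField.adjoin ℚ ({β} : Set (AlgebraicClosure ℚ))) 2, κP.IsCyclotomic →
      ∃ n : ℕ, classGroupPRank κP (n + 1) = classGroupPRank κP n) :
    MazurMainConjecture c2045b1 2 :=
  mazurMainConjecture_two_of_muIneqRel_of_classGroupPRank_succ_eq c2045b1 h17 hGr hper hmod hGZK hI
    goodOrd_two_2045b1 not_hasRationalTwoTorsionX_2045b1 Δ_2045b1_neg hr0 hμan (bsdp_two_2045b1_of_creutzMiller hCM hGZK hr0) hβ hcert

/-- **THE ROW AT `2045b1`, the `(0, 1)` RANK certificate: `rank₂ Cl(ℚ(β)(√2)) = rank₂ Cl(ℚ(β))`** (for every cyclotomic `ℤ₂`-extension `κP` of `ℚ(β)`,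
`κP.layer 1 ≅ ℚ(β)(√2)`) ⟹ `MC₂(2045b1)`, granted PRINT⁵ + Creutz–Miller + MuIneqʳ + the seed's analytic data. CONDITIONAL; BSD is NOT proved.
[cite: Fukuda1994, Thm. 1 (2), p. 264] [cite: CreutzMiller2012, Thm. 1.1] [cite: Kato2004Asterisque, Thm. 17.4 (1)(2) (p. 273)] -/
theorem mazurMainConjecture_two_2045b1_of_rankCert_layerZero
    (h17 : ∀ [NeZero (c2045b1.conductorNorm ℤ)] (f : CuspForm (Gamma0 (c2045b1.conductorNorm ℤ)) 2),
      kato_divisibility_allPrimes c2045b1 2 (f := f))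
    (hGr : Greenberg1999.thm41_charValue_rankZero_anyPrime)
    (hper : realPeriodRat_eq_unit_mul_plusPeriod_two) (hmod : nonempty_modularParametrizationData)
    (hGZK : rank_eq_analyticRank_of_analyticRank_le_one) (hCM : bsdTriple_of_rank_le_one_of_conductor_lt)
    (hI : ∀ (W : WeierstrassCurve ℚ) [W.IsElliptic] [W.IsGloballyMinimal], IsOrdinaryAt W 2 →
      (∀ x : ℚ, ¬ HasRationalTwoTorsionX W x) →
      ∀ (κ : ZpExtension ℚ 2) (γ : Field.absoluteGaloisGroup ℚ), κ.IsCyclotomic →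
      κ.IsTopGenerator γ → IsCyclotomicVariable 2 γ →
      ∀ ⦃N : ℕ⦄ [NeZero N] (f : CuspForm (Gamma0 N) 2), IsNewformOf W f →
      ∀ Gp : IwasawaAlgebra 2, iwasawaToPowerSeries 2 Gp = padicLFunction f (unitRoot W 2 : ℚ_[2]) →
      ∀ (D : W.SelmerDualData κ γ) (Yr : W.FineSelmerDualDataRelaxedInf κ γ),
        lengthAt (IwasawaAlgebra 2) D.X ⟨IwasawaAlgebra.augIdealP 2, IwasawaAlgebra.isPrime_augIdealP_holds 2⟩ ≤
          lengthAt (IwasawaAlgebra 2) (IwasawaAlgebra 2 ⧸ Ideal.span {Gp})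
              ⟨IwasawaAlgebra.augIdealP 2, IwasawaAlgebra.isPrime_augIdealP_holds 2⟩ +
            lengthAt (IwasawaAlgebra 2) Yr.X ⟨IwasawaAlgebra.augIdealP 2, IwasawaAlgebra.isPrime_augIdealP_holds 2⟩)
    (hr0 : c2045b1.analyticRank = 0)
    (hμan : ∀ ⦃N : ℕ⦄ [NeZero N] (f : CuspForm (Gamma0 N) 2), IsNewformOf c2045b1 f →
      ∀ G : IwasawaAlgebra 2, IsEvenBranchLiftAtTwo c2045b1 f G → red G ≠ 0)
    {β : AlgebraicClosure ℚ} (hβ : aeval β c2045b1.twoTorsionPolynomial.toPoly = 0)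
    (hrank : ∀ κP : ZpExtension ↥(IntermediateField.adjoin ℚ ({β} : Set (AlgebraicClosure ℚ))) 2, κP.IsCyclotomic →
      classGroupPRank κP 1 = classGroupPRank κP 0) :
    MazurMainConjecture c2045b1 2 :=
  mazurMainConjecture_two_2045b1_of_rankCert_anyLayer h17 hGr hper hmod hGZK hCM hI hr0 hμan hβ fun κP hκP => ⟨0, hrank κP hκP⟩

/-- **THE ROW AT `2045b1`, the `(0, 1)` CLASS-NUMBER certificate: `ord₂ h(ℚ(β)(√2)) = ord₂ h(ℚ(β))`** (every cyclotomic `κP`) ⟹ `MC₂(2045b1)`, granted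
PRINT⁵ + Creutz–Miller + MuIneqʳ + the seed's analytic data. CONDITIONAL; BSD is NOT proved. [cite: Fukuda1994, Thm. 1 (1), p. 264] [cite: CreutzMiller2012, Thm. 1.1]
[cite: Kato2004Asterisque, Thm. 17.4 (1)(2) (p. 273)] -/
theorem mazurMainConjecture_two_2045b1_of_classNumberCert_layerZero
    (h17 : ∀ [NeZero (c2045b1.conductorNorm ℤ)] (f : CuspForm (Gamma0 (c2045b1.conductorNorm ℤ)) 2),
      kato_divisibility_allPrimes c2045b1 2 (f := f))
    (hGr : Greenberg1999.thm41_charValue_rankZero_anyPrime)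
    (hper : realPeriodRat_eq_unit_mul_plusPeriod_two) (hmod : nonempty_modularParametrizationData)
    (hGZK : rank_eq_analyticRank_of_analyticRank_le_one) (hCM : bsdTriple_of_rank_le_one_of_conductor_lt)
    (hI : ∀ (W : WeierstrassCurve ℚ) [W.IsElliptic] [W.IsGloballyMinimal], IsOrdinaryAt W 2 →
      (∀ x : ℚ, ¬ HasRationalTwoTorsionX W x) →
      ∀ (κ : ZpExtension ℚ 2) (γ : Field.absoluteGaloisGroup ℚ), κ.IsCyclotomic →
      κ.IsTopGenerator γ → IsCyclotomicVariable 2 γ →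
      ∀ ⦃N : ℕ⦄ [NeZero N] (f : CuspForm (Gamma0 N) 2), IsNewformOf W f →
      ∀ Gp : IwasawaAlgebra 2, iwasawaToPowerSeries 2 Gp = padicLFunction f (unitRoot W 2 : ℚ_[2]) →
      ∀ (D : W.SelmerDualData κ γ) (Yr : W.FineSelmerDualDataRelaxedInf κ γ),
        lengthAt (IwasawaAlgebra 2) D.X ⟨IwasawaAlgebra.augIdealP 2, IwasawaAlgebra.isPrime_augIdealP_holds 2⟩ ≤
          lengthAt (IwasawaAlgebra 2) (IwasawaAlgebra 2 ⧸ Ideal.span {Gp})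
              ⟨IwasawaAlgebra.augIdealP 2, IwasawaAlgebra.isPrime_augIdealP_holds 2⟩ +
            lengthAt (IwasawaAlgebra 2) Yr.X ⟨IwasawaAlgebra.augIdealP 2, IwasawaAlgebra.isPrime_augIdealP_holds 2⟩)
    (hr0 : c2045b1.analyticRank = 0)
    (hμan : ∀ ⦃N : ℕ⦄ [NeZero N] (f : CuspForm (Gamma0 N) 2), IsNewformOf c2045b1 f →
      ∀ G : IwasawaAlgebra 2, IsEvenBranchLiftAtTwo c2045b1 f G → red G ≠ 0)
    {β : AlgebraicClosure ℚ} (hβ : aeval β c2045b1.twoTorsionPolynomial.toPoly = 0)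
    (hcl : ∀ κP : ZpExtension ↥(IntermediateField.adjoin ℚ ({β} : Set (AlgebraicClosure ℚ))) 2, κP.IsCyclotomic →
      classNumberPExp κP 1 = classNumberPExp κP 0) :
    MazurMainConjecture c2045b1 2 :=
  mazurMainConjecture_two_of_muIneqRel_of_classNumberPExp_succ_eq c2045b1 h17 hGr hper hmod hGZK hI
    goodOrd_two_2045b1 not_hasRationalTwoTorsionX_2045b1 Δ_2045b1_neg hr0 hμan (bsdp_two_2045b1_of_creutzMiller hCM hGZK hr0) hβ
    fun κP hκP => ⟨0, hcl κP hκP⟩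

/-- **THE ROW AT `2045b1` BY CHEVALLEY'S DOOR**: `h(ℚ(β))` odd and a unit `ε` of `𝓞 ℚ(β)` not of the form `a² − 2b²` (displayed) ⟹ `MC₂(2045b1)`, granted
PRINT⁵ + Creutz–Miller + MuIneqʳ + the seed's analytic data (`Δ_min ≡ 3 (8)`, so p748062's odd-index bit was UNSATISFIABLE here; the door of
`…FukudaIndexDoors` needs none). CONDITIONAL; BSD is NOT proved. [cite: Lang1990, Ch. 13 §4, Lemma 4.1] [cite: Fukuda1994, Thm. 1 (1), p. 264]
[cite: CreutzMiller2012, Thm. 1.1] [cite: Kato2004Asterisque, Thm. 17.4 (1)(2) (p. 273)] -/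
theorem mazurMainConjecture_two_2045b1_of_chevalley
    (h17 : ∀ [NeZero (c2045b1.conductorNorm ℤ)] (f : CuspForm (Gamma0 (c2045b1.conductorNorm ℤ)) 2),
      kato_divisibility_allPrimes c2045b1 2 (f := f))
    (hGr : Greenberg1999.thm41_charValue_rankZero_anyPrime)
    (hper : realPeriodRat_eq_unit_mul_plusPeriod_two) (hmod : nonempty_modularParametrizationData)
    (hGZK : rank_eq_analyticRank_of_analyticRank_le_one) (hCM : bsdTriple_of_rank_le_one_of_conductor_lt)
    (hI : ∀ (W : WeierstrassCurve ℚ) [W.IsElliptic] [W.IsGloballyMinimal], IsOrdinaryAt W 2 →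
      (∀ x : ℚ, ¬ HasRationalTwoTorsionX W x) →
      ∀ (κ : ZpExtension ℚ 2) (γ : Field.absoluteGaloisGroup ℚ), κ.IsCyclotomic →
      κ.IsTopGenerator γ → IsCyclotomicVariable 2 γ →
      ∀ ⦃N : ℕ⦄ [NeZero N] (f : CuspForm (Gamma0 N) 2), IsNewformOf W f →
      ∀ Gp : IwasawaAlgebra 2, iwasawaToPowerSeries 2 Gp = padicLFunction f (unitRoot W 2 : ℚ_[2]) →
      ∀ (D : W.SelmerDualData κ γ) (Yr : W.FineSelmerDualDataRelaxedInf κ γ),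
        lengthAt (IwasawaAlgebra 2) D.X ⟨IwasawaAlgebra.augIdealP 2, IwasawaAlgebra.isPrime_augIdealP_holds 2⟩ ≤
          lengthAt (IwasawaAlgebra 2) (IwasawaAlgebra 2 ⧸ Ideal.span {Gp})
              ⟨IwasawaAlgebra.augIdealP 2, IwasawaAlgebra.isPrime_augIdealP_holds 2⟩ +
            lengthAt (IwasawaAlgebra 2) Yr.X ⟨IwasawaAlgebra.augIdealP 2, IwasawaAlgebra.isPrime_augIdealP_holds 2⟩)
    (hr0 : c2045b1.analyticRank = 0)
    (hμan : ∀ ⦃N : ℕ⦄ [NeZero N] (f : CuspForm (Gamma0 N) 2), IsNewformOf c2045b1 f →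
      ∀ G : IwasawaAlgebra 2, IsEvenBranchLiftAtTwo c2045b1 f G → red G ≠ 0)
    {β : AlgebraicClosure ℚ} (hβ : aeval β c2045b1.twoTorsionPolynomial.toPoly = 0)
    (hh : haveI : FiniteDimensional ℚ ↥(IntermediateField.adjoin ℚ ({β} : Set (AlgebraicClosure ℚ))) :=
        IntermediateField.adjoin.finiteDimensional ((AlgebraicClosure.isAlgebraic ℚ).isAlgebraic β).isIntegral
      haveI : NumberField ↥(IntermediateField.adjoin ℚ ({β} : Set (AlgebraicClosure ℚ))) := NumberField.mk
      ¬ 2 ∣ classNumber ↥(IntermediateField.adjoin ℚ ({β} : Set (AlgebraicClosure ℚ))))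
    {ε : 𝓞 ↥(IntermediateField.adjoin ℚ ({β} : Set (AlgebraicClosure ℚ)))} (hεu : IsUnit ε)
    (hnn : ∀ a b : ↥(IntermediateField.adjoin ℚ ({β} : Set (AlgebraicClosure ℚ))),
      (ε : ↥(IntermediateField.adjoin ℚ ({β} : Set (AlgebraicClosure ℚ)))) ≠ a ^ 2 - 2 * b ^ 2) :
    MazurMainConjecture c2045b1 2 :=
  mazurMainConjecture_two_of_muIneqRel_of_chevalley_of_minimalDiscriminantInt_emod_eight_ne_one c2045b1 h17 hGr hper hmod hGZK hI
    goodOrd_two_2045b1 not_hasRationalTwoTorsionX_2045b1 Δ_2045b1_neg hr0 hμan (bsdp_two_2045b1_of_creutzMiller hCM hGZK hr0)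
    (by have h := minimalDiscriminantInt_emod_eight_2045b1; omega) hβ hh hεu hnn

end Summit.BirchSwinnertonDyer.BirchSwinnertonDyer.Theorems.AlignedTransportAtTwoCubicOffStratumFukudaIndexRow2045b1

end
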